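import Summits.ResolutionOfSingularities.ResolutionOfSingularities.Theorems.FrobeniusClosingPatchingRelPerfectDepthSNCPointwise
import Literature.AlgebraicGeometry.Resolution.SncSaturatedCentre
import Mathlib.RingTheory.Nakayama
import Mathlib.LinearAlgebra.Finsupp.LinearCombination
import HarnessLib

/-!
# Crux `PatchingRelPerfect` (stmt-ResolutionOfSingularities-16161), chain W5.2 — END-SNC / F6 stage-2 feeders:
# the GENERAL MEMBER SWAP for simple normal crossings at a point

[OURS · L1 W5.2 · rung tool] Replaces the role of NO printed item; NOT a statement of the manuscript under review; fact-free,
pure local algebra + bookkeeping. At a weight-one centre point `x = i z` of F6 stage 2 (res-L1-w52-plan-1, TargetsF6 part S: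
`StepSepOne`, incl. PEEL centres) the X-side pocket field needs `SNCWithAt (𝓗 :: charged carriers) Ĉ x` — the HOST in place of
the exceptional hypersurface `E` in the family lifted from the E-side (`SNCWithAt (𝓘_E :: boundary) Ĉ x`). When some kept member
CONTAINS the centre (PEEL: `Ĉ = (g, e)`; curve centres inside a carrier), res-type-049's insertion lemmas (`…DepthSNCExchange`:
members TRANSVERSAL to the centre) do not apply; what works is to SWAP the coordinate of one member `A` (here `A = 𝓘_E`) for the
host's equation `h`. This file proves the swap under the canonical (rsop-independent) cotangent condition
«`h ∈ A_x + N′ + 𝔪_x²` and `h ∉ N′ + 𝔪_x²`», `N′` the sum of the stalks of the other named members: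

* `coeff_mem_maximalIdeal_of_sum_mem_sq` — a minimal generating system of `𝔪` is linearly independent modulo `𝔪²` (Nakayama;
  the tree's `not_mem_sq_of_span_eq_maximalIdeal` is the one-element case);
* `index_mem_of_mem_span_image` — `v_i ∈ (v_j : j ∈ S) ⇒ i ∈ S`;
* **`SNCWithAt.swap`** — the general member swap;
* **`SNCWithAt.tangent_swap`** (`N′ = 0`: `h ≡ unit·a mod 𝔪²`, the host TANGENT to `E` = F6's `¬ OrdLeOneAt`, X-side automatic)
  and **`SNCWithAt.coincidence_swap`** (`N′ = G_x`: the host trace COINCIDES with the trace of a carrier `G` and `H ⋔ G`) —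
  feeders (c) and (b) of res-D-pv-009's q5′ answer (2026-08-27T09:22:07Z).

## References
* H. Matsumura, *Commutative Ring Theory* (1986), Thm. 2.3 (Nakayama), Thm. 14.2. [Matsumura1987]
* E. Bierstone, D. Grigoriev, P. Milman, J. Włodarczyk, arXiv:1206.3090, Def. 3.1.1, Def. 3.1.3 (2). [BierstoneGrigorievMilmanWlodarczyk2011]
* J. Kollár, *Lectures on Resolution of Singularities* (2007), Def. 3.24, Cor. 3.85. [Kollar2007]
-/

-- `Summit.<Summit>.<Sub>.Theorems` with `Sub = Summit` (single-conjunct summit, D-0017)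
set_option linter.dupNamespace false

noncomputable section

open CategoryTheory CategoryTheory.Limits AlgebraicGeometry TopologicalSpace IsLocalRing
open Literature.AlgebraicGeometry.Resolution

namespace Summit.ResolutionOfSingularities.ResolutionOfSingularities.Theorems

universe u

namespace DepthSNC

/-! ## §1 Local algebra: a minimal generating system of `𝔪` is independent modulo `𝔪²` -/

section LocalAlgebra

variable {R : Type u} [CommRing R] [IsLocalRing R] [IsNoetherianRing R] {d : ℕ}

/-- **A minimal generating system of the maximal ideal is linearly independent modulo `𝔪²`** (Nakayama): if
`v₁, …, v_d` generate `𝔪` with `d ≤ spanFinrank 𝔪` and `Σ cᵢ vᵢ ∈ 𝔪²`, then every `cᵢ ∈ 𝔪`. [cite: Matsumura1987, Thm. 2.3] -/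
theorem coeff_mem_maximalIdeal_of_sum_mem_sq (v : Fin d → R) (hv : Ideal.span (Set.range v) = maximalIdeal R)
    (hd : d ≤ (maximalIdeal R).spanFinrank) (c : Fin d → R)
    (hsum : ∑ i, c i * v i ∈ maximalIdeal R ^ 2) (i₀ : Fin d) : c i₀ ∈ maximalIdeal R := by
  classical
  by_contra hc
  have hu : IsUnit (c i₀) := by
    by_contra hnu
    exact hc ((IsLocalRing.mem_maximalIdeal _).mpr (mem_nonunits_iff.mpr hnu))
  obtain ⟨u, hu⟩ := hu
  -- `𝔪 = (v_j : j ≠ i₀) + 𝔪²`, hence `𝔪 = (v_j : j ≠ i₀)` by Nakayama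
  set N : Ideal R := Ideal.span (((Finset.univ.erase i₀).image v : Finset R) : Set R) with hN
  have hvN : ∀ j, j ≠ i₀ → v j ∈ N := fun j hj =>
    Ideal.subset_span (Finset.mem_coe.mpr (Finset.mem_image_of_mem _ (Finset.mem_erase.mpr ⟨hj, Finset.mem_univ j⟩)))
  have hrest : ∑ j ∈ Finset.univ.erase i₀, c j * v j ∈ N :=
    Ideal.sum_mem _ fun j hj => Ideal.mul_mem_left _ _ (hvN j (Finset.ne_of_mem_erase hj))
  have hsplit : c i₀ * v i₀ = (∑ i, c i * v i) - ∑ j ∈ Finset.univ.erase i₀, c j * v j := by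
    rw [← Finset.add_sum_erase Finset.univ (fun j => c j * v j) (Finset.mem_univ i₀)]
    ring
  have hvi₀ : v i₀ ∈ N ⊔ (maximalIdeal R) • (maximalIdeal R) := by
    have h1 : c i₀ * v i₀ ∈ N ⊔ (maximalIdeal R) • (maximalIdeal R) := by
      rw [hsplit]
      refine Ideal.sub_mem _ (Ideal.mem_sup_right ?_) (Ideal.mem_sup_left hrest)
      rw [Ideal.smul_eq_mul, ← pow_two]
      exact hsum
    have h2 : v i₀ = ↑u⁻¹ * (c i₀ * v i₀) := by rw [← hu, ← mul_assoc, Units.inv_mul, one_mul]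
    rw [h2]
    exact Ideal.mul_mem_left _ _ h1
  have hle : maximalIdeal R ≤ N ⊔ (maximalIdeal R) • (maximalIdeal R) := by
    conv_lhs => rw [← hv]
    rw [Ideal.span_le]
    rintro y ⟨j, rfl⟩
    by_cases hj : j = i₀
    · subst hj; exact hvi₀
    · exact Ideal.mem_sup_left (hvN j hj)
  have hfg : (maximalIdeal R).FG := (isNoetherianRing_iff_ideal_fg R).mp inferInstance _
  have hjac : maximalIdeal R ≤ (⊥ : Ideal R).jacobson := by
    rw [IsLocalRing.jacobson_eq_maximalIdeal ⊥ bot_ne_top]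
  have hmN : maximalIdeal R ≤ N := Submodule.le_of_le_smul_of_le_jacobson_bot hfg hjac hle
  have hNm : N ≤ maximalIdeal R := by
    rw [hN, Ideal.span_le]
    intro y hy
    obtain ⟨j, -, rfl⟩ := Finset.mem_image.mp (Finset.mem_coe.mp hy)
    rw [← hv]; exact Ideal.subset_span ⟨j, rfl⟩
  have hEq : N = maximalIdeal R := le_antisymm hNm hmN
  have h1 : (maximalIdeal R).spanFinrank ≤ ((Finset.univ.erase i₀).image v).card := by
    rw [← hEq, hN]
    exact Submodule.spanFinrank_span_le_ncard_of_finite (Finset.finite_toSet _) |>.trans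
      (by rw [Set.ncard_coe_finset])
  have h2 : ((Finset.univ.erase i₀).image v).card ≤ (Finset.univ.erase i₀).card := Finset.card_image_le
  have h3 : (Finset.univ.erase i₀).card < d := by
    rw [Finset.card_erase_of_mem (Finset.mem_univ _), Finset.card_univ, Fintype.card_fin]
    exact Nat.sub_lt (Fin.pos i₀) Nat.one_pos
  omega

omit [IsLocalRing R] [IsNoetherianRing R] in
/-- Coefficients of an element of `(v_j : j ∈ S)`. [folklore] -/
theorem exists_coeff_of_mem_span_image (v : Fin d → R) (S : Set (Fin d)) {h : R}
    (hh : h ∈ Ideal.span (v '' S)) : ∃ c : Fin d → R, (∀ j, j ∉ S → c j = 0) ∧ ∑ j, c j * v j = h := by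
  classical
  obtain ⟨l, hl, hlh⟩ := (Finsupp.mem_span_image_iff_linearCombination R (v := v)).mp hh
  refine ⟨l, fun j hj => (Finsupp.mem_supported' R l).mp hl j hj, ?_⟩
  rw [← hlh, Finsupp.linearCombination_apply, Finsupp.sum_fintype]
  · simp only [smul_eq_mul]
  · intro j; exact zero_smul _ _

/-- **`v_i ∈ (v_j : j ∈ S)` forces `i ∈ S`** for a minimal generating system of `𝔪`. [cite: Matsumura1987, Thm. 2.3] -/
theorem index_mem_of_mem_span_image (v : Fin d → R) (hv : Ideal.span (Set.range v) = maximalIdeal R)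
    (hd : d ≤ (maximalIdeal R).spanFinrank) {i : Fin d} {S : Set (Fin d)}
    (h : v i ∈ Ideal.span (v '' S)) : i ∈ S := by
  classical
  by_contra hi
  obtain ⟨c, hcS, hc⟩ := exists_coeff_of_mem_span_image v S h
  -- `Σ (c_j - δ_{ij}) v_j = 0 ∈ 𝔪²`, with coefficient `-1` at `i`
  have hsum : ∑ j, (c j - if j = i then 1 else 0) * v j ∈ maximalIdeal R ^ 2 := by
    have : ∑ j, (c j - if j = i then 1 else 0) * v j = 0 := by
      simp only [sub_mul, Finset.sum_sub_distrib, hc, ite_mul, one_mul, zero_mul, Finset.sum_ite_eq',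
        Finset.mem_univ, if_true, sub_self]
    rw [this]; exact Ideal.zero_mem _
  have h1 := coeff_mem_maximalIdeal_of_sum_mem_sq v hv hd _ hsum i
  rw [hcS i hi, if_pos rfl, zero_sub] at h1
  have h2 : (1 : R) ∈ maximalIdeal R := by simpa using (maximalIdeal R).neg_mem h1
  exact (IsLocalRing.maximalIdeal.isMaximal R).ne_top ((Ideal.eq_top_iff_one _).mpr h2)

end LocalAlgebra

/-! ## §2 The member swap -/

variable {X : Scheme.{u}} {L L' M' : List X.IdealSheafData} {C A 𝓗 : X.IdealSheafData} {x : X}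

/-- [OURS · L1 W5.2] **GENERAL MEMBER SWAP for simple normal crossings at a point.** Let `L` be snc with `C` at `x`, `A ∈ L`
a member through `x` with `A_x ⊆ C_x`, `𝓗` an ideal sheaf through `x` with principal stalk `𝓗_x = (h)`, `h ∈ C_x`; let `M′` be a
list of members of `L` through `x` other than `A`, `N′ = Σ_{D ∈ M′} D_x`. If `h ∈ A_x + N′ + 𝔪_x²` and `h ∉ N′ + 𝔪_x²` (the
coefficient of `A`'s coordinate in `h` is a unit — an rsop-independent condition), then `𝓗 :: L′` is snc with `C` at `x` for
every `L′` whose members through `x` are members of `L` other than `A`: the regular system of parameters is modified by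
`v_A ↦ h`, an EXACT exchange since `h ∈ C_x = (v_S)` with a unit coefficient at `A`'s index (independence of an rsop modulo
`𝔪²`), so that `C_x = (v′_S)` and every other member keeps its coordinate. [cite: Matsumura1987, Thm. 14.2]
[cite: BierstoneGrigorievMilmanWlodarczyk2011, Def. 3.1.3 (2)] [cite: Kollar2007, Cor. 3.85] -/
theorem SNCWithAt.swap (hL : SNCWithAt L C x) (hA : A ∈ L) (hxA : x ∈ A.support)
    (hAC : stalkIdeal A x ≤ stalkIdeal C x) (hx𝓗 : x ∈ 𝓗.support) {h : X.presheaf.stalk x}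
    (h𝓗 : stalkIdeal 𝓗 x = Ideal.span {h}) (hhC : h ∈ stalkIdeal C x)
    (hM' : ∀ D ∈ M', D ∈ L ∧ x ∈ D.support ∧ D ≠ A)
    (hin : h ∈ stalkIdeal A x ⊔ (⨆ D ∈ M', stalkIdeal D x) ⊔ maximalIdeal (X.presheaf.stalk x) ^ 2)
    (hout : h ∉ (⨆ D ∈ M', stalkIdeal D x) ⊔ maximalIdeal (X.presheaf.stalk x) ^ 2)
    (hL' : ∀ D ∈ L', x ∈ D.support → D ∈ L ∧ D ≠ A) :
    SNCWithAt (𝓗 :: L') C x := by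
  classical
  obtain ⟨hreg, d, v, hd, hv, ⟨ι, hι, hιD⟩, hC⟩ := hL
  haveI := hreg
  set a₀ : Fin d := ι ⟨A, hA, hxA⟩ with ha₀
  have hdle : d ≤ (maximalIdeal (X.presheaf.stalk x)).spanFinrank := le_of_eq hd.symm
  have hAst : stalkIdeal A x = Ideal.span {v a₀} := hιD ⟨A, hA, hxA⟩
  have hvj𝔪 : ∀ j, v j ∈ maximalIdeal (X.presheaf.stalk x) := fun j => by
    rw [← hv]; exact Ideal.subset_span ⟨j, rfl⟩
  have hh𝔪 : h ∈ maximalIdeal (X.presheaf.stalk x) :=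
    (mem_support_iff_stalkIdeal_le 𝓗 x).mp hx𝓗 (h𝓗 ▸ Ideal.mem_span_singleton_self h)
  -- labels of the other members avoid `a₀`
  have hιne : ∀ (D : X.IdealSheafData) (hDL : D ∈ L) (hxD : x ∈ D.support), D ≠ A → ι ⟨D, hDL, hxD⟩ ≠ a₀ := by
    intro D hDL hxD hDA heq
    exact hDA (congrArg Subtype.val (hι heq))
  -- `N′ ≤ (v_j : j ≠ a₀)`
  have hN' : (⨆ D ∈ M', stalkIdeal D x) ≤ Ideal.span (v '' {j | j ≠ a₀}) := by
    refine iSup₂_le fun D hD => ?_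
    obtain ⟨hDL, hxD, hDA⟩ := hM' D hD
    rw [hιD ⟨D, hDL, hxD⟩, Ideal.span_singleton_le_iff_mem]
    exact Ideal.subset_span ⟨ι ⟨D, hDL, hxD⟩, hιne D hDL hxD hDA, rfl⟩
  -- the index set `S₀` carrying `h` (the centre's, or everything off the centre)
  obtain ⟨S₀, ha₀S, hhS, hCS⟩ : ∃ S₀ : Set (Fin d), a₀ ∈ S₀ ∧ h ∈ Ideal.span (v '' S₀) ∧
      (x ∈ C.support → stalkIdeal C x = Ideal.span (v '' S₀)) := by
    by_cases hxC : x ∈ C.support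
    · obtain ⟨S, hS⟩ := hC hxC
      refine ⟨S, ?_, hS ▸ hhC, fun _ => hS⟩
      apply index_mem_of_mem_span_image v hv hdle
      rw [← hS]
      exact hAC (hAst ▸ Ideal.mem_span_singleton_self _)
    · refine ⟨Set.univ, trivial, ?_, fun h' => absurd h' hxC⟩
      rw [Set.image_univ, hv]; exact hh𝔪
  obtain ⟨c, hcS, hc⟩ := exists_coeff_of_mem_span_image v S₀ hhS
  -- the coefficient of `v a₀` in `h` is a unit
  have hca₀ : IsUnit (c a₀) := by
    by_contra hnu
    have hcm : c a₀ ∈ maximalIdeal (X.presheaf.stalk x) :=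
      (IsLocalRing.mem_maximalIdeal _).mpr (mem_nonunits_iff.mpr hnu)
    rw [hAst] at hin
    obtain ⟨y, hy, q, hq, hyq⟩ := Submodule.mem_sup.mp hin
    obtain ⟨p, hp, n, hn, hpn⟩ := Submodule.mem_sup.mp hy
    obtain ⟨α, rfl⟩ := Ideal.mem_span_singleton'.mp hp
    obtain ⟨e, heS, he⟩ := exists_coeff_of_mem_span_image v {j | j ≠ a₀} (hN' hn)
    have hea₀ : e a₀ = 0 := heS a₀ (by simp)
    -- the combined relation `Σ (c_j - e_j - α δ_{j a₀}) v_j = q ∈ 𝔪²`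
    have hrel : ∑ j, (c j - e j - if j = a₀ then α else 0) * v j = q := by
      have h1 : ∑ j, (c j - e j - if j = a₀ then α else 0) * v j =
          (∑ j, c j * v j) - (∑ j, e j * v j) - ∑ j, (if j = a₀ then α else 0) * v j := by
        simp only [sub_mul, Finset.sum_sub_distrib]
      have h2 : ∑ j, (if j = a₀ then α else 0) * v j = α * v a₀ := by
        simp only [ite_mul, zero_mul, Finset.sum_ite_eq', Finset.mem_univ, if_true]
      rw [h1, hc, he, h2, ← hyq, ← hpn]; ring
    have hmem := coeff_mem_maximalIdeal_of_sum_mem_sq v hv hdle _ (hrel ▸ hq) a₀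
    rw [hea₀, if_pos rfl, sub_zero] at hmem
    have hα : α ∈ maximalIdeal (X.presheaf.stalk x) := by
      have := Ideal.sub_mem _ hcm hmem
      rwa [sub_sub_cancel] at this
    apply hout
    -- `h = n + (α v a₀ + q)`
    have hh : h = n + (α * v a₀ + q) := by rw [← hyq, ← hpn]; ring
    rw [hh]
    refine Ideal.add_mem _ (Ideal.mem_sup_left hn) (Ideal.mem_sup_right (Ideal.add_mem _ ?_ hq))
    rw [pow_two]; exact Ideal.mul_mem_mul hα (hvj𝔪 a₀)
  obtain ⟨u, hu⟩ := hca₀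
  -- `v a₀` in terms of `h` and the other coordinates
  have hsplit : c a₀ * v a₀ = h - ∑ j ∈ Finset.univ.erase a₀, c j * v j := by
    rw [← hc, ← Finset.add_sum_erase Finset.univ (fun j => c j * v j) (Finset.mem_univ a₀)]
    ring
  have hva₀ : v a₀ = ↑u⁻¹ * (h - ∑ j ∈ Finset.univ.erase a₀, c j * v j) := by
    rw [← hsplit, ← hu, ← mul_assoc, Units.inv_mul, one_mul]
  -- the new system
  set v' : Fin d → X.presheaf.stalk x := Function.update v a₀ h with hv'def
  have hv'a₀ : v' a₀ = h := Function.update_self ..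
  have hv'ne : ∀ j, j ≠ a₀ → v' j = v j := fun j hj => Function.update_of_ne hj ..
  -- `v a₀ ∈ (v'_j : j ∈ T)` for any index set `T ∋ a₀` containing the support of `c`
  have hva₀mem : ∀ T : Set (Fin d), a₀ ∈ T → (∀ j, c j ≠ 0 → j ∈ T) → v a₀ ∈ Ideal.span (v' '' T) := by
    intro T ha₀T hcT
    rw [hva₀]
    refine Ideal.mul_mem_left _ _ (Ideal.sub_mem _ (Ideal.subset_span ⟨a₀, ha₀T, hv'a₀⟩)
      (Ideal.sum_mem _ fun j hj => ?_))
    by_cases hcj : c j = 0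
    · rw [hcj, zero_mul]; exact Ideal.zero_mem _
    · refine Ideal.mul_mem_left _ _ (Ideal.subset_span ⟨j, hcT j hcj, ?_⟩)
      exact hv'ne j (Finset.ne_of_mem_erase hj)
  have hspan : Ideal.span (Set.range v') = maximalIdeal (X.presheaf.stalk x) := by
    apply le_antisymm
    · rw [Ideal.span_le]
      rintro y ⟨j, rfl⟩
      by_cases hj : j = a₀
      · subst hj; rw [hv'a₀]; exact hh𝔪
      · rw [hv'ne j hj]; exact hvj𝔪 j
    · rw [← hv, Ideal.span_le]
      rintro y ⟨j, rfl⟩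
      by_cases hj : j = a₀
      · subst hj
        have h1 := hva₀mem Set.univ trivial (fun _ _ => trivial)
        rwa [Set.image_univ] at h1
      · exact Ideal.subset_span ⟨j, hv'ne j hj⟩
  refine ⟨hreg, d, v', hd, hspan, ?_, ?_⟩
  · -- labels
    let ι' : {D : X.IdealSheafData // D ∈ 𝓗 :: L' ∧ x ∈ D.support} → Fin d := fun D =>
      if hD : D.1 = 𝓗 then a₀
      else ι ⟨D.1, (hL' D.1 ((List.mem_cons.mp D.2.1).resolve_left hD) D.2.2).1, D.2.2⟩
    have hι'𝓗 : ∀ D (hD : D.1 = 𝓗), ι' D = a₀ := fun D hD => by simp only [ι', dif_pos hD]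
    have hι'ne : ∀ D (hD : D.1 ≠ 𝓗), ι' D =
        ι ⟨D.1, (hL' D.1 ((List.mem_cons.mp D.2.1).resolve_left hD) D.2.2).1, D.2.2⟩ := fun D hD => by
      simp only [ι', dif_neg hD]
    refine ⟨ι', ?_, ?_⟩
    · intro D₁ D₂ heq
      by_cases h₁ : D₁.1 = 𝓗 <;> by_cases h₂ : D₂.1 = 𝓗
      · exact Subtype.ext (h₁.trans h₂.symm)
      · exfalso
        have hDL := hL' D₂.1 ((List.mem_cons.mp D₂.2.1).resolve_left h₂) D₂.2.2
        rw [hι'𝓗 D₁ h₁, hι'ne D₂ h₂] at heq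
        exact hιne D₂.1 hDL.1 D₂.2.2 hDL.2 heq.symm
      · exfalso
        have hDL := hL' D₁.1 ((List.mem_cons.mp D₁.2.1).resolve_left h₁) D₁.2.2
        rw [hι'ne D₁ h₁, hι'𝓗 D₂ h₂] at heq
        exact hιne D₁.1 hDL.1 D₁.2.2 hDL.2 heq
      · rw [hι'ne D₁ h₁, hι'ne D₂ h₂] at heq
        have hv := congrArg Subtype.val (hι heq)
        exact Subtype.ext hv
    · intro D
      by_cases hD : D.1 = 𝓗
      · rw [hι'𝓗 D hD, hv'a₀, hD, h𝓗]
      · have hDL := hL' D.1 ((List.mem_cons.mp D.2.1).resolve_left hD) D.2.2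
        rw [hι'ne D hD, hv'ne _ (hιne D.1 hDL.1 D.2.2 hDL.2)]
        exact hιD ⟨D.1, hDL.1, D.2.2⟩
  · -- the centre
    intro hxC
    refine ⟨S₀, ?_⟩
    have hCx := hCS hxC
    apply le_antisymm
    · rw [hCx, Ideal.span_le]
      rintro y ⟨j, hj, rfl⟩
      by_cases hja : j = a₀
      · subst hja
        exact hva₀mem S₀ ha₀S fun j hcj => by by_contra hjS; exact hcj (hcS j hjS)
      · exact Ideal.subset_span ⟨j, hj, hv'ne j hja⟩
    · rw [Ideal.span_le]
      rintro y ⟨j, hj, rfl⟩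
      by_cases hja : j = a₀
      · subst hja; rw [hv'a₀]; exact hhC
      · rw [hv'ne j hja, hCx]; exact Ideal.subset_span ⟨j, hj, rfl⟩

/-! ## §3 The two F6 feeders -/

/-- [OURS · L1 W5.2] **TANGENT SWAP** (F6 stage 2, feeder (c): the host `H` TANGENT to the member `A = 𝓘_E` at `x`, i.e.
`h ∈ A_x + 𝔪_x²` with `h ∉ 𝔪_x²` — F6's `¬ OrdLeOneAt`, X-side automatic): `𝓗 :: L′` is snc with `C` at `x` for every `L′` of
members of `L` other than `A`. [cite: Matsumura1987, Thm. 14.2] -/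
theorem SNCWithAt.tangent_swap (hL : SNCWithAt L C x) (hA : A ∈ L) (hxA : x ∈ A.support)
    (hAC : stalkIdeal A x ≤ stalkIdeal C x) (hx𝓗 : x ∈ 𝓗.support) {h : X.presheaf.stalk x}
    (h𝓗 : stalkIdeal 𝓗 x = Ideal.span {h}) (hhC : h ∈ stalkIdeal C x)
    (hin : h ∈ stalkIdeal A x ⊔ maximalIdeal (X.presheaf.stalk x) ^ 2)
    (hout : h ∉ maximalIdeal (X.presheaf.stalk x) ^ 2)
    (hL' : ∀ D ∈ L', x ∈ D.support → D ∈ L ∧ D ≠ A) :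
    SNCWithAt (𝓗 :: L') C x := by
  refine hL.swap (M' := []) hA hxA hAC hx𝓗 h𝓗 hhC (fun D hD => by simp at hD) ?_ ?_ hL'
  · simpa using hin
  · simpa using hout

/-- [OURS · L1 W5.2] **COINCIDENCE SWAP** (F6 stage 2, feeder (b): the host trace COINCIDES at `x` with the trace of a kept
member `G` — `h ∈ G_x + A_x`, `A = 𝓘_E` — and `H ⋔ G` at `x` — `h ∉ G_x + 𝔪_x²`): `𝓗 :: L′` is snc with `C` at `x` for every `L′`
of members of `L` other than `A` (e.g. the charged carriers, `G` among them). [cite: Kollar2007, Cor. 3.85] -/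
theorem SNCWithAt.coincidence_swap (hL : SNCWithAt L C x) (hA : A ∈ L) (hxA : x ∈ A.support)
    (hAC : stalkIdeal A x ≤ stalkIdeal C x) (hx𝓗 : x ∈ 𝓗.support) {h : X.presheaf.stalk x}
    (h𝓗 : stalkIdeal 𝓗 x = Ideal.span {h}) (hhC : h ∈ stalkIdeal C x)
    {G : X.IdealSheafData} (hG : G ∈ L) (hxG : x ∈ G.support) (hGA : G ≠ A)
    (hin : h ∈ stalkIdeal G x ⊔ stalkIdeal A x)
    (hout : h ∉ stalkIdeal G x ⊔ maximalIdeal (X.presheaf.stalk x) ^ 2)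
    (hL' : ∀ D ∈ L', x ∈ D.support → D ∈ L ∧ D ≠ A) :
    SNCWithAt (𝓗 :: L') C x := by
  have hsup : (⨆ D ∈ [G], stalkIdeal D x) = stalkIdeal G x := by
    apply le_antisymm
    · exact iSup₂_le fun D hD => by rw [List.mem_singleton.mp hD]
    · exact le_iSup₂ (f := fun D (_ : D ∈ [G]) => stalkIdeal D x) G (List.mem_singleton_self G)
  refine hL.swap (M' := [G]) hA hxA hAC hx𝓗 h𝓗 hhC ?_ ?_ ?_ hL'
  · intro D hD
    rw [List.mem_singleton.mp hD]
    exact ⟨hG, hxG, hGA⟩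
  · rw [hsup]
    obtain ⟨g, hg, a, ha, hga⟩ := Submodule.mem_sup.mp hin
    rw [← hga, add_comm]
    exact Ideal.mem_sup_left (Ideal.add_mem _ (Ideal.mem_sup_left ha) (Ideal.mem_sup_right hg))
  · rw [hsup]; exact hout

end DepthSNC

end Summit.ResolutionOfSingularities.ResolutionOfSingularities.Theorems

end
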